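import Summits.QuantumFields.YangMills.Theses.GradientFlowWitness
import HarnessLib

/-!
# Route `GradientFlowWitness`, crux `FlowedResponseFloor` (stmt-QuantumFields-25684): vocabulary of the
# BC3 split «window ∧ finite-size» (skeleton registered on the item; R3/RECORD framing — nothing asserted)

Definition helper file (D-0016 `<Route><Crux>Defs`, `--supports stmt-QuantumFields-25684`) typing, over tree
objects only, the functional and the two statements of the planner's BC3 birth skeleton for the deciding crux
`Summit.QuantumFields.YangMills.Theses.GradientFlowWitness.FlowedResponseFloor` (route DRAFT, tribunal pending),
so that its registered stubs `stub_window : FlowedResponseFloorWindow`, `stub_finiteSize :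
FlowedResponseFiniteSize` have importable signatures, plus the kernel-checked bookkeeping around them:

* `mirrorDouble L U` — the mirror-doubled torus configuration `hat U` of the crux (links of `ℤ⁴` with base time
  in `[0, L−1]` kept, the antipodal slice `|t| = L` set to `1`, the negative half filled with the OS
  site-reflection image), as a configuration of the torus `(ℤ/(2L+1))⁴`; `continuous_mirrorDouble`.
* `probe` = `X̂_w(U) = Σ_{x ∈ box L} w(a(β)x) ρ₀⁴ E_T(x̄)[hat U]`, `T = (ρ₀/a(β))²` (the femto-flowed energy probe,
  tree `LatticeWilsonFlow.flowedEnergy`), `leg` = `Ṽ_v(U) = Σ_y v(a(β)y) dens_y(U)` (the bare action-density leg),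
  `resp` = `Cov_T(X̂_w∘cfgReflect, Ṽ_v)` on the torus `2L+1`; `continuous_probe`, `continuous_leg`,
  `exists_abs_probe_le`, `exists_abs_leg_le` (admissibility: bounded continuous observables of the compact
  configuration space), `posSlab` / `mirrorDouble_congr` / `isCylinder_probe` (the probe is a cylinder observable of
  the links with base time in `[0, L−1]` — the positive-time measurability the RP lemmas consume; extracted from the
  route's `closes`) and `resp_eq_deriv_tilted` — the Feynman–Hellmann reading: `resp` IS the derivative at `0`
  of the one-point function of `Ṽ_v` under Wilson's torus measure tilted by `t·X̂_w∘Θ₀` (tree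
  `ConjugateResponse.mirrorCov_eq_deriv_tilted`), i.e. the quantity the crux floors is a first-order response.
* `FlowedResponseFloorWindow` (stub 1 of the split: the floor `ε₁ ≤ |resp|` on tori whose size in units `a(β)`
  lies in a bounded window `[Λ₅, Λ₆]`, every `Λ₆`, threshold `β₆(Λ₆)`), `FlowedResponseFiniteSize` (stub 2: β-uniform
  finite-size control of `resp` — the route's «W2» typed once).  NEITHER IS ASSERTED.
* `flowedResponseFloor_iff` (`Iff.rfl`: the crux IS `∃ r a … ε₁ ≤ |resp|`, so everything here is literally
  about the route decl), `flowedResponseFloorWindow_of_flowedResponseFloor` (the window statement is formally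
  BELOW the crux: implied by it), and the composition `flowedResponseFloor_of_window_of_finiteSize :
  FlowedResponseFloorWindow → FlowedResponseFiniteSize → FlowedResponseFloor` (the crux with half the floor:
  compare any large torus with the comparison torus `L = ⌈M/a(β)⌉₊` inside the window `[M, M+1]`).

HONEST FRAMING (prover seat `ym-line-gfw-p1`, 2026-08-28).  Definitions, admissibility and two implications;
no floor, no ceiling, nothing about `FlowedResponseFloor`, `BalabanLadder.NT`, the Yang–Mills mass gap or any
summit is proved here or claimed.  The prover's verdict on `stub_window` (it is the dimensional-transmutation
wall for a mixed flowed/bare two-point function, in bounded-volume clothing — not a perturbative rung) is recorded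
on the item, not in this file. [cite: Luscher2010, eqs. (1.4), (3.1)] [cite: OsterwalderSeiler1978, §2]
-/

set_option autoImplicit false

noncomputable section

open scoped BigOperators Topology
open Filter Set MeasureTheory
open Literature.MathematicalPhysics.QuantumFieldTheory Literature.MathematicalPhysics.QuantumLattice
open Literature.MathematicalPhysics.AQFT Literature.Probability.LatticeModels
open Summit.QuantumFields.YangMills.Cruxes.OSLegsFromFemtoAndGap.DlrCollarTransfer

namespace Summit.QuantumFields.YangMills.Cruxes.FlowedResponseFloor.WindowSplit

/-! ## §1 The mirror-doubled torus configuration -/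

section Vocabulary

variable (G : Type) [Group G]

/-- **The mirror-doubled torus configuration `hat U`** of the crux `FlowedResponseFloor`, on the torus
`(ℤ/(2L+1))⁴` (coordinates read through `ZMod.valMinAbs ∈ [−L, L]`): a link whose base point has time coordinate
`±L` (the antipodal slice) carries `1`; a link with base time `t ∈ [0, L−1]` carries the `ℤ⁴`-link `U` at the
same coordinates; a link with base time `t ∈ [−(L−1), −1]` carries the OS site-reflection image — the temporal link
`t → t+1` is `(U((−t−1, x⃗), 0))⁻¹`, a spatial link is `U((−t, x⃗), i)`.  So every observable of `hat U` reads
links of `U` with base time in `[0, L−1]` only (positive-time measurability of the flowed probe). -/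
def mirrorDouble (L : ℕ) (U : LGConfig 4 G) : GaugeConfig 4 (2 * L + 1) G := fun e =>
  if ((e.1 0).valMinAbs).natAbs = L then (1 : G)
  else if 0 ≤ (e.1 0).valMinAbs then U (fun i => (e.1 i).valMinAbs, e.2)
  else if e.2 = 0 then (U (Function.update (fun i => (e.1 i).valMinAbs) 0 (-(e.1 0).valMinAbs - 1), 0))⁻¹
  else U (Function.update (fun i => (e.1 i).valMinAbs) 0 (-(e.1 0).valMinAbs), e.2)

variable [TopologicalSpace G]

/-- **The femto-flowed energy probe `X̂_w`** of the crux on the torus `2L+1` at inverse coupling `β`, in units `a`: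
`X̂_w(U) = Σ_{x ∈ box L} w(a(β)·x) · ρ₀⁴ · E_T(x̄)[hat U]`, Wilson flow time `T = (ρ₀/a(β))²` lattice units
(tree `flowedEnergy`, Lüscher's plaquette density (3.1)), run on the mirror-doubled configuration.  `ρ₀⁴ E_T` is
the correctly weighted Riemann summand of `∫ w · t²E_t` (`t = ρ₀²` physical). [cite: Luscher2010, eq. (3.1)] -/
def probe (r : LatticeRep G) (a : ℝ → ℝ) (ρ₀ : ℝ) (w : SchwartzMap (EuclideanSpace ℝ (Fin 4)) ℝ) (β : ℝ)
    (L : ℕ) (U : LGConfig 4 G) : ℝ :=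
  ∑ x ∈ box 4 L, w (a β • siteToE x) *
    (ρ₀ ^ 4 * flowedEnergy r.ρ ((ρ₀ / a β) ^ 2) (fun i => ((x i : ℤ) : ZMod (2 * L + 1))) (mirrorDouble G L U))

variable [IsTopologicalGroup G]

/-- `U ↦ hat U` is continuous (each link of `hat U` is a constant, a coordinate of `U`, or the inverse of one). -/
theorem continuous_mirrorDouble (L : ℕ) : Continuous (mirrorDouble G L) := by
  refine continuous_pi fun e => ?_
  dsimp only [mirrorDouble]
  by_cases h1 : ((e.1 0).valMinAbs).natAbs = L
  · simp only [h1, ↓reduceIte]; exact continuous_const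
  · simp only [h1, ↓reduceIte]
    by_cases h2 : 0 ≤ (e.1 0).valMinAbs
    · simp only [h2, ↓reduceIte]; exact continuous_apply _
    · simp only [h2, ↓reduceIte]
      by_cases h3 : e.2 = 0
      · simp only [h3, ↓reduceIte]; exact (continuous_apply _).inv
      · simp only [h3, ↓reduceIte]; exact continuous_apply _

variable {G} in
/-- The flowed probe is a continuous observable (continuity of the torus Wilson flow in the configuration, tree
`TorusWilsonFlowContinuity.continuous_flowedEnergy`, composed with `continuous_mirrorDouble`). -/
theorem continuous_probe (r : LatticeRep G) (a : ℝ → ℝ) (ρ₀ : ℝ) (w : SchwartzMap (EuclideanSpace ℝ (Fin 4)) ℝ)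
    (β : ℝ) (L : ℕ) : Continuous (probe G r a ρ₀ w β L) := by
  refine continuous_finsetSum _ fun x _ => continuous_const.mul (continuous_const.mul ?_)
  exact (continuous_flowedEnergy r.ρ r.continuous r.mem_unitary _ _).comp (continuous_mirrorDouble G L)

/-- **The positive slab of links read by the probe**: base point in `box L` with time coordinate in `[0, L−1]`, any
direction (the edge set `SX` of the route's `closes`). -/
def posSlab (L : ℕ) : Finset (Literature.MathematicalPhysics.QuantumLattice.ZdEdge 4) :=
  ((box 4 L).filter fun x => 0 ≤ x 0 ∧ x 0 + 1 ≤ (L : ℤ)) ×ˢ (Finset.univ : Finset (Fin 4))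

omit [TopologicalSpace G] [IsTopologicalGroup G] in
variable {G} in
/-- Every link of the positive slab has base time in `[0, L−1]` (the window hypothesis of
`MarkovMirror.dependsOn_posHalf_of_window`). -/
theorem posSlab_window (L : ℕ) : ∀ e ∈ posSlab L, 0 ≤ e.1 0 ∧ e.1 0 + 1 ≤ (L : ℤ) := fun e he => by
  simp only [posSlab, Finset.mem_product, Finset.mem_filter] at he; exact he.1.2

omit [TopologicalSpace G] [IsTopologicalGroup G] in
variable {G} in
/-- `hat U` reads only the links of `U` in the positive slab: configurations agreeing there have the same double. -/
theorem mirrorDouble_congr (L : ℕ) {U W : LGConfig 4 G} (hUW : ∀ e ∈ posSlab L, U e = W e) :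
    mirrorDouble G L U = mirrorDouble G L W := by
  have hval : ∀ z : ZMod (2 * L + 1), -(L : ℤ) ≤ z.valMinAbs ∧ z.valMinAbs ≤ L := fun z => by
    have := ZMod.natAbs_valMinAbs_le z; omega
  have hbx : ∀ e : Edge 4 (2 * L + 1), ∀ c : ℤ, 0 ≤ c → c + 1 ≤ (L : ℤ) → ∀ j : Fin 4,
      (Function.update (fun i => (e.1 i).valMinAbs) 0 c, j) ∈ posSlab L := by
    intro e c hc0 hc1 j
    refine Finset.mem_product.2 ⟨Finset.mem_filter.2 ⟨mem_box.2 fun i => ?_, ?_⟩, Finset.mem_univ _⟩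
    · by_cases hi : i = 0
      · subst hi; simp only [Function.update_self]; omega
      · simp only [Function.update_of_ne hi]; exact hval (e.1 i)
    · simp only [Function.update_self]; omega
  funext e
  have h0 := hval (e.1 0)
  dsimp only [mirrorDouble]
  split_ifs with h1 h2 h3
  · rfl
  · have := hbx e _ h2 (by omega) e.2
    simp only [Function.update_eq_self] at this
    exact hUW _ this
  · rw [hUW _ (hbx e (-(e.1 0).valMinAbs - 1) (by omega) (by omega) 0)]
  · exact hUW _ (hbx e (-(e.1 0).valMinAbs) (by omega) (by omega) e.2)

omit [IsTopologicalGroup G] in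
variable {G} in
/-- **The flowed probe is a cylinder observable of the positive slab** (so, read through the periodic lift, it is
measurable with respect to the closed non-negative half of the odd torus — the input of the RP lemmas
`NT.Reflection.sq_cov_negReflect_le_odd_pos` / `MarkovMirror.dependsOn_posHalf_of_window`). -/
theorem isCylinder_probe (r : LatticeRep G) (a : ℝ → ℝ) (ρ₀ : ℝ) (w : SchwartzMap (EuclideanSpace ℝ (Fin 4)) ℝ)
    (β : ℝ) (L : ℕ) : IsCylinder (probe G r a ρ₀ w β L) (posSlab L) := by
  intro U W hUW
  have hH : mirrorDouble G L U = mirrorDouble G L W := mirrorDouble_congr L fun e he => hUW e he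
  simp only [probe, hH]

variable [CompactSpace G]

variable {G} in
/-- The flowed probe is bounded on the (compact) configuration space of `ℤ⁴`. -/
theorem exists_abs_probe_le (r : LatticeRep G) (a : ℝ → ℝ) (ρ₀ : ℝ)
    (w : SchwartzMap (EuclideanSpace ℝ (Fin 4)) ℝ) (β : ℝ) (L : ℕ) :
    ∃ K : ℝ, ∀ U, |probe G r a ρ₀ w β L U| ≤ K := by
  obtain ⟨K, hK⟩ := isCompact_univ.exists_bound_of_continuousOn (continuous_probe r a ρ₀ w β L).continuousOn
  exact ⟨K, fun U => by simpa only [Real.norm_eq_abs] using hK U (Set.mem_univ U)⟩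

/-! ## §2 The bare leg and the response functional (these read Wilson's torus measure) -/

variable [MeasurableSpace G] [BorelSpace G]

/-- **The bare action-density leg `Ṽ_v`**: `Ṽ_v(U) = Σ_{y ∈ box L} v(a(β)·y) · dens_y(U)` (`dens` = the curvature
species `Σ_{i<j} Re tr r(U_p)` over the six plaquettes based at `y`). -/
def leg (r : LatticeRep G) (a : ℝ → ℝ) (v : SchwartzMap (EuclideanSpace ℝ (Fin 4)) ℝ) (β : ℝ) (L : ℕ)
    (U : LGConfig 4 G) : ℝ :=
  ∑ y ∈ box 4 L, v (a β • siteToE y) * dens G r y U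

/-- **The flowed response functional** `R_{β,L} = Cov_T(X̂_w∘cfgReflect, Ṽ_v) =
torusE[(X̂_w∘Θ₀)·Ṽ_v] − torusE[X̂_w]·torusE[Ṽ_v]` of the crux, as a function of the torus size `L`. -/
def resp (r : LatticeRep G) (a : ℝ → ℝ) (ρ₀ : ℝ) (w v : SchwartzMap (EuclideanSpace ℝ (Fin 4)) ℝ) (β : ℝ)
    (L : ℕ) : ℝ :=
  torusE G r β L (fun U => probe G r a ρ₀ w β L (cfgReflect U) * leg G r a v β L U) -
    torusE G r β L (probe G r a ρ₀ w β L) * torusE G r β L (leg G r a v β L)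

variable {G} in
/-- The bare leg is a continuous observable. -/
theorem continuous_leg (r : LatticeRep G) (a : ℝ → ℝ) (v : SchwartzMap (EuclideanSpace ℝ (Fin 4)) ℝ) (β : ℝ)
    (L : ℕ) : Continuous (leg G r a v β L) :=
  continuous_finsetSum _ fun y _ => continuous_const.mul (continuous_dens r y)

variable {G} in
/-- The bare leg is bounded on the (compact) configuration space of `ℤ⁴`. -/
theorem exists_abs_leg_le (r : LatticeRep G) (a : ℝ → ℝ) (v : SchwartzMap (EuclideanSpace ℝ (Fin 4)) ℝ)
    (β : ℝ) (L : ℕ) : ∃ K : ℝ, ∀ U, |leg G r a v β L U| ≤ K := by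
  obtain ⟨K, hK⟩ := isCompact_univ.exists_bound_of_continuousOn (continuous_leg r a v β L).continuousOn
  exact ⟨K, fun U => by simpa only [Real.norm_eq_abs] using hK U (Set.mem_univ U)⟩

/-- **Feynman–Hellmann reading of the flowed response** (layer-2 item F1 of the route's two-layer plan, kernel
form): `resp = d/dt|_{t=0} ∫ Ṽ_v∘lift d(μ_T.tilted(t · X̂_w∘Θ₀∘lift))` — the crux floors the FIRST-ORDER RESPONSE of
the one-point function of the bare smeared action density to a tilt of Wilson's torus measure by the reflected
flowed probe (equivalently, by `torusE_comp_cfgReflect`, the response of `⟨X̂_w⟩` to the local coupling modulation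
`β ↦ β + t·v(a(β)·θy)` on the mirror side).  Tree `ConjugateResponse.mirrorCov_eq_deriv_tilted`. -/
theorem resp_eq_deriv_tilted (r : LatticeRep G) (a : ℝ → ℝ) (ρ₀ : ℝ)
    (w v : SchwartzMap (EuclideanSpace ℝ (Fin 4)) ℝ) (β : ℝ) (L : ℕ) :
    resp G r a ρ₀ w v β L =
      deriv (fun t => ∫ U, leg G r a v β L (torusLift (2 * L + 1) U)
        ∂((wilsonMeasure (d := 4) (L := 2 * L + 1) r.ρ β).tilted
          fun U => t * probe G r a ρ₀ w β L (cfgReflect (torusLift (2 * L + 1) U)))) 0 := by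
  obtain ⟨KF, hKF⟩ := exists_abs_probe_le r a ρ₀ w β L
  obtain ⟨KW, hKW⟩ := exists_abs_leg_le r a v β L
  exact Cruxes.NT.ConjugateResponse.mirrorCov_eq_deriv_tilted G r β L (continuous_probe r a ρ₀ w β L)
    (continuous_leg r a v β L) hKF hKW

end Vocabulary

/-! ## §3 The two statements of the split (NOT asserted) and the crux in this vocabulary -/

/-- **Stub 1 of the BC3 split — the femto-WINDOW floor** (`stub_window`; the planner's BC5 «plan-only rung»).
For every compact simple `G`: a faithful lattice representation `r`, a unit `a(β) > 0`, `a → 0`, and for every femto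
radius `ℓ > 0` data `ρ₀ > 0`, Schwartz `w`, `v` (`tsupport v ⊆ {y₀ > 0} ∩ B(0, ℓ)`), `ε₁ > 0`, `β₅`, `Λ₅` such that
for EVERY window ceiling `Λ₆` there is a threshold `β₆` with `ε₁ ≤ |resp|` for all `β ≥ max β₅ β₆` on all tori
`2L+1` with `Λ₅ ≤ a(β)·L ≤ Λ₆`.  Formally below the crux (`flowedResponseFloorWindow_of_flowedResponseFloor`);
differs from it only in that the torus size in units `a(β)` is bounded by a `β`-independent `Λ₆`.  NOT ASSERTED;
prover record 2026-08-28: not a perturbative statement (see the item's evidence). -/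
def FlowedResponseFloorWindow : Prop :=
  ∀ (G : Type) [Group G] [TopologicalSpace G] [IsTopologicalGroup G] [CompactSpace G],
    IsCompactSimpleLieGroup G →
    letI : MeasurableSpace G := borel G
    haveI : BorelSpace G := ⟨rfl⟩
    ∃ (r : LatticeRep G) (a : ℝ → ℝ), (∀ β, 0 < a β) ∧ Tendsto a atTop (nhds 0) ∧
      ∀ ℓ : ℝ, 0 < ℓ → ∃ (ρ₀ : ℝ) (w v : SchwartzMap (EuclideanSpace ℝ (Fin 4)) ℝ) (ε₁ β₅ Λ₅ : ℝ),
        0 < ρ₀ ∧ tsupport (v : EuclideanSpace ℝ (Fin 4) → ℝ) ⊆ {y | 0 < y 0} ∧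
        tsupport (v : EuclideanSpace ℝ (Fin 4) → ℝ) ⊆ Metric.closedBall 0 ℓ ∧ 0 < ε₁ ∧
        ∀ Λ₆ : ℝ, ∃ β₆ : ℝ, ∀ β : ℝ, β₅ ≤ β → β₆ ≤ β → ∀ L : ℕ, Λ₅ ≤ a β * L → a β * L ≤ Λ₆ →
          ε₁ ≤ |resp G r a ρ₀ w v β L|

/-- **Stub 2 of the BC3 split — β-uniform finite-size control of the response** (`stub_finiteSize`; the route's
«W2» typed once): for every compact simple `G`, every `r`, every unit `a` (positive, `→ 0`), every `ρ₀ > 0`, Schwartz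
`w, v` and `η > 0` there are `Λ₆, β₆` with `|resp(β, L') − resp(β, L)| ≤ η` whenever `β ≥ β₆` and
`Λ₆ ≤ a(β)·L`, `L ≤ L'`.  A convergence-type statement (no floor by itself).  NOT ASSERTED. -/
def FlowedResponseFiniteSize : Prop :=
  ∀ (G : Type) [Group G] [TopologicalSpace G] [IsTopologicalGroup G] [CompactSpace G],
    IsCompactSimpleLieGroup G →
    letI : MeasurableSpace G := borel G
    haveI : BorelSpace G := ⟨rfl⟩
    ∀ (r : LatticeRep G) (a : ℝ → ℝ), (∀ β, 0 < a β) → Tendsto a atTop (nhds 0) →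
      ∀ (ρ₀ : ℝ), 0 < ρ₀ → ∀ (w v : SchwartzMap (EuclideanSpace ℝ (Fin 4)) ℝ) (η : ℝ), 0 < η →
        ∃ Λ₆ β₆ : ℝ, ∀ β : ℝ, β₆ ≤ β → ∀ L L' : ℕ, Λ₆ ≤ a β * L → L ≤ L' →
          |resp G r a ρ₀ w v β L' - resp G r a ρ₀ w v β L| ≤ η

/-- **The crux in this vocabulary** (definitional unfolding): `FlowedResponseFloor` IS the statement that some
`(r, a)` carries, at every femto radius, data with `ε₁ ≤ |resp G r a ρ₀ w v β L|` for all `β ≥ β₅` and all tori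
`a(β)·L ≥ Λ₅` — the inline `hat / X / V` lets of the route decl are `mirrorDouble / probe / leg`. -/
theorem flowedResponseFloor_iff :
    Summit.QuantumFields.YangMills.Theses.GradientFlowWitness.FlowedResponseFloor ↔
    ∀ (G : Type) [Group G] [TopologicalSpace G] [IsTopologicalGroup G] [CompactSpace G],
      IsCompactSimpleLieGroup G →
      letI : MeasurableSpace G := borel G
      haveI : BorelSpace G := ⟨rfl⟩
      ∃ (r : LatticeRep G) (a : ℝ → ℝ), (∀ β, 0 < a β) ∧ Tendsto a atTop (nhds 0) ∧
        ∀ ℓ : ℝ, 0 < ℓ → ∃ (ρ₀ : ℝ) (w v : SchwartzMap (EuclideanSpace ℝ (Fin 4)) ℝ) (ε₁ β₅ Λ₅ : ℝ),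
          0 < ρ₀ ∧ tsupport (v : EuclideanSpace ℝ (Fin 4) → ℝ) ⊆ {y | 0 < y 0} ∧
          tsupport (v : EuclideanSpace ℝ (Fin 4) → ℝ) ⊆ Metric.closedBall 0 ℓ ∧ 0 < ε₁ ∧
          ∀ β : ℝ, β₅ ≤ β → ∀ L : ℕ, Λ₅ ≤ a β * L → ε₁ ≤ |resp G r a ρ₀ w v β L| :=
  Iff.rfl

/-- **The window statement is formally below the crux**: `FlowedResponseFloor → FlowedResponseFloorWindow`
(drop the window ceiling `Λ₆`; `β₆ := β₅`). -/
theorem flowedResponseFloorWindow_of_flowedResponseFloor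
    (h : Summit.QuantumFields.YangMills.Theses.GradientFlowWitness.FlowedResponseFloor) :
    FlowedResponseFloorWindow := by
  intro G _ _ _ _ hG
  letI : MeasurableSpace G := borel G
  haveI : BorelSpace G := ⟨rfl⟩
  obtain ⟨r, a, ha, ha0, hfl⟩ := h G hG
  refine ⟨r, a, ha, ha0, fun ℓ hℓ => ?_⟩
  obtain ⟨ρ₀, w, v, ε₁, β₅, Λ₅, hρ, hv1, hv2, hε, hF⟩ := hfl ℓ hℓ
  exact ⟨ρ₀, w, v, ε₁, β₅, Λ₅, hρ, hv1, hv2, hε, fun _ => ⟨β₅, fun β hβ _ L hL _ => hF β hβ L hL⟩⟩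

/-- **The composition of the BC3 split**: window floor + β-uniform finite-size control ⇒ the crux, with half the
floor.  For the data of the window statement at radius `ℓ` and `η = ε₁/2`, put `M := max (max Λ₅ Λ₆) 0` and use the
window `[Λ₅, M+1]`; a torus with `a(β)L' > M+1` is compared with the torus `L := ⌈M/a(β)⌉₊`, which lies in the
window once `a(β) < 1` and satisfies `L ≤ L'`, `a(β)L ≥ Λ₆`. -/
theorem flowedResponseFloor_of_window_of_finiteSize (hW : FlowedResponseFloorWindow)
    (hF : FlowedResponseFiniteSize) :
    Summit.QuantumFields.YangMills.Theses.GradientFlowWitness.FlowedResponseFloor := by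
  intro G _ _ _ _ hG
  letI : MeasurableSpace G := borel G
  haveI : BorelSpace G := ⟨rfl⟩
  obtain ⟨r, a, ha, ha0, hwin⟩ := hW G hG
  refine ⟨r, a, ha, ha0, ?_⟩
  intro ℓ hℓ
  obtain ⟨ρ₀, w, v, ε₁, β₅, Λ₅, hρ, hv1, hv2, hε, hfl⟩ := hwin ℓ hℓ
  obtain ⟨Λ₆, β₆, hfs⟩ := hF G hG r a ha ha0 ρ₀ hρ w v (ε₁ / 2) (by positivity)
  set M : ℝ := max (max Λ₅ Λ₆) 0 with hM
  have hM0 : 0 ≤ M := le_max_right _ _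
  have h5M : Λ₅ ≤ M := le_trans (le_max_left _ _) (le_max_left _ _)
  have h6M : Λ₆ ≤ M := le_trans (le_max_right _ _) (le_max_left _ _)
  obtain ⟨β₆', hfl'⟩ := hfl (M + 1)
  have hev : ∀ᶠ β in atTop, a β < 1 := ha0.eventually (gt_mem_nhds one_pos)
  obtain ⟨βa, hβa⟩ := Filter.eventually_atTop.mp hev
  refine ⟨ρ₀, w, v, ε₁ / 2, max (max β₅ β₆) (max β₆' βa), M, hρ, hv1, hv2, by positivity, ?_⟩
  intro β hβ L' hL'
  have hβ5 : β₅ ≤ β := le_trans (le_trans (le_max_left _ _) (le_max_left _ _)) hβ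
  have hβ6 : β₆ ≤ β := le_trans (le_trans (le_max_right _ _) (le_max_left _ _)) hβ
  have hβ6' : β₆' ≤ β := le_trans (le_trans (le_max_left _ _) (le_max_right _ _)) hβ
  have hβa' : βa ≤ β := le_trans (le_trans (le_max_right _ _) (le_max_right _ _)) hβ
  have haβ : 0 < a β := ha β
  have ha1 : a β < 1 := hβa β hβa'
  have hL'5 : Λ₅ ≤ a β * L' := le_trans h5M hL'
  show ε₁ / 2 ≤ |resp G r a ρ₀ w v β L'|
  by_cases hcase : a β * L' ≤ M + 1
  · have h1 := hfl' β hβ5 hβ6' L' hL'5 hcase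
    linarith [abs_nonneg (resp G r a ρ₀ w v β L')]
  · push Not at hcase
    let L : ℕ := ⌈M / a β⌉₊
    have hx : 0 ≤ M / a β := div_nonneg hM0 haβ.le
    have hLlo : M ≤ a β * (L : ℝ) := by
      have : M / a β ≤ (L : ℝ) := Nat.le_ceil _
      calc M = a β * (M / a β) := by field_simp
        _ ≤ a β * (L : ℝ) := mul_le_mul_of_nonneg_left this haβ.le
    have hLhi : a β * (L : ℝ) < M + 1 := by
      have : (L : ℝ) < M / a β + 1 := Nat.ceil_lt_add_one hx
      calc a β * (L : ℝ) < a β * (M / a β + 1) := mul_lt_mul_of_pos_left this haβ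
        _ = M + a β := by field_simp
        _ < M + 1 := by linarith
    have hL6 : Λ₆ ≤ a β * (L : ℝ) := le_trans h6M hLlo
    have hL5 : Λ₅ ≤ a β * (L : ℝ) := le_trans h5M hLlo
    have hLL' : L ≤ L' := by
      have h' : a β * (L : ℝ) < a β * (L' : ℝ) := lt_trans hLhi hcase
      have : (L : ℝ) < (L' : ℝ) := lt_of_mul_lt_mul_left h' haβ.le
      exact_mod_cast this.le
    have h1 := hfl' β hβ5 hβ6' L hL5 hLhi.le
    have h2 := hfs β hβ6 L L' hL6 hLL'
    have h3 := abs_sub_abs_le_abs_sub (resp G r a ρ₀ w v β L) (resp G r a ρ₀ w v β L')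
    rw [abs_sub_comm] at h3
    linarith

end Summit.QuantumFields.YangMills.Cruxes.FlowedResponseFloor.WindowSplit

end
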